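import Summits.BirchSwinnertonDyer.BirchSwinnertonDyer.Theorems.ThetaPartnerAtTwoSignedMainConjectureCMTwoRankZeroLowerOffTwoSplit
import Summits.BirchSwinnertonDyer.BirchSwinnertonDyer.Theses.ThetaPartnerAtTwo
import HarnessLib

/-!
# Route `ThetaPartnerAtTwo` (TP2), crux K2R0P♭ `SignedMainConjectureCMTwoRankZeroOfPubOfFlat` (stmt-BirchSwinnertonDyer-26471; derived node K2r0P
# stmt-BirchSwinnertonDyer-24945): **THE CRUX BY NAME, MODULO (CORE♭-lower)_pair** — the ONE registered stub of line `rankzero` v17 with its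
# (ERL♭ ⊇) clause in the K3 column's finite-level currency (ERL_pair) ON THE layer pairings — and MODULO ITS TWO-STUB SPLIT (S_PT) ∧ (S_ZETA)

HONEST FRAMING (cell `pub/bsd-wall`, W-ALL row 1; width seat `bsd-wall-tp2-p2-w2` g4, `--supports` only; the lead lineage `bsd-wall-tp2-p2` holds the
item). THREE THEOREMS, IMPLICATIONS whose antecedents carry all research / published content (Honda ∧ (PT♭)_layer ∧ (ERL_pair) ∧ (g)^ι); CONDITIONAL —
they close NO item (`proof.conditional`); the crux is NOT proved; BSD is NOT proved by any of this. They are the certificates a pen / lead cites if the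
stub is re-texted as (CORE♭-lower)_pair (the CM twin of K3's `CoreFin.signedKatoDivisibilityUpToAtTwoOfPub_of_corePair`, p621423) — then ONE promoted
PUB item «explicit reciprocity law at finite level on THE layer pairing vs. the Mazur–Tate elements» serves the (ERL) clause of K3, K3P′ and K2R0P♭.

## What is proved
* `signedMainConjectureCMTwoRankZeroOfPubOfFlat_of_coreLowerPair : (CORE♭-lower)_pair → SignedMainConjectureCMTwoRankZeroOfPubOfFlat` — the v17
  composition (`signedMainConjectureCMTwoRankZero_body_of_pub_of_offTwoLower_of_flat`, w2 g2 p610476) with the stub fed by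
  `offTwoLower_of_coreLowerPair` (this seat).
* `signedMainConjectureCMTwoRankZeroOfPubOfFlat_of_poitouTateDeepTwo_of_zetaErlLower` — K2R0P♭ BY NAME ⟸ (S_PT) ∧ (S_ZETA), the two-stub
  split of the stub (`offTwoLower_of_poitouTateDeepTwo_of_zetaErlLower`: (S_PT) = the `Λ`-adic Poitou–Tate deep half on THE pairing, (P3) in
  Literature names `CyclotomicLayer.tatePairingPk`; (S_ZETA) = Honda ∧ (ERL_pair) ∧ (g)^ι, the CM twin of K3's CORE_pair).
* `signedMainConjectureCMTwoRankZeroOfPubOfFlat_of_poitouTateDeepTwoGen_of_zetaErlLower` — the same with (S_PT) in general form (every elliptic `A/ℚ`).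

References: [Kobayashi2003] Thm. 6.3, 7.3, (8.23), Prop. 8.25; [Kato2004Asterisque] Conj. 12.10, Thm. 12.5, §15.12–15.16, §17.13; [Sprung2012] Def. 3.1,
Prop. 6.3–6.5; [PollackRubin2004] Thm. 7.3; [JohnsonLeungKings2011] Thm. 5.2.
-/

set_option autoImplicit false
-- the Theorems namespace of this sub repeats the summit name by design (D-0017 nested layout)
set_option linter.dupNamespace false

noncomputable section

open scoped Classical NumberField MatrixGroups ModularForm

open NumberField IsDedekindDomain CongruenceSubgroup Polynomial

namespace Summit.BirchSwinnertonDyer.BirchSwinnertonDyer.Theorems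

namespace SignedLowerOffTwo

open Literature.NumberTheory.EllipticCurves Literature.NumberTheory.GaloisRepresentations
  WeierstrassCurve ZpExtension Literature.NumberTheory.EllipticCurves.Kobayashi2003
  Literature.NumberTheory.EllipticCurves.Module Literature.NumberTheory.EllipticCurves.Kato2004
  Literature.NumberTheory.EllipticCurves.Kato2004.EulerSystemValues
  Literature.NumberTheory.EllipticCurves.GreenbergSelmer Literature.NumberTheory.EllipticCurves.Sprung2012
  Literature.NumberTheory.EllipticCurves.ModularForms Literature.NumberTheory.EllipticCurves.Rank1Residual
  Summit.BirchSwinnertonDyer.Rank1Residual.Supersingular SignedKatoOffTwo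

/-- **K2R0P♭ `SignedMainConjectureCMTwoRankZeroOfPubOfFlat` BY NAME from (CORE♭-lower)_pair** (clause-by-clause reading of the hypothesis:
`offTwoLower_of_coreLowerPair`): PUB¹⁰ → FLAT → the K2r0 body, with (LDℓ)_A supplied by `offTwoLower_of_coreLowerPair hpair` and the turnkey
`signedMainConjectureCMTwoRankZero_body_of_pub_of_offTwoLower_of_flat`. CONDITIONAL on `hpair`; closes nothing.
[cite: Kato2004Asterisque, Thm. 12.5 (p. 222), Conj. 12.10 (p. 224), §17.13 (p. 280)] [cite: Kobayashi2003, Thm. 7.3 (pp. 12–13), Prop. 8.25]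
[cite: PollackRubin2004, Thm. 7.3] [cite: Sprung2012, Def. 3.1 (p. 1489), Prop. 6.3–6.5 (pp. 1496–1497)] -/
theorem signedMainConjectureCMTwoRankZeroOfPubOfFlat_of_coreLowerPair
    (hpair : ∀ (v : HeightOneSpectrum (𝓞 ℚ)), ((2 : ℕ) : 𝓞 ℚ) ∈ v.asIdeal →
      ∀ (A : WeierstrassCurve ℚ) [A.IsElliptic] [A.IsGloballyMinimal],
        A.HasCM → A.analyticRank = 0 → GoodSS A 2 → A.frobeniusTrace 2 = 0 →
        2 ∣ A.shaOrder * A.tamagawaProduct →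
        ∀ (κ : ZpExtension ℚ 2) (γ : Field.absoluteGaloisGroup ℚ),
          κ.IsCyclotomic → κ.IsTopGenerator γ → IsCyclotomicVariable 2 γ →
        ∀ [NeZero (A.conductorNorm ℤ)] (f : CuspForm (Gamma0 (A.conductorNorm ℤ)) 2),
          IsNewformOf A f → ∀ (ϖ : ℚ), (ϖ : ℝ) * A.realPeriodRat = plusPeriod f →
        ∀ (Lplus Lminus : IwasawaAlgebra 2), IsPollackPair f 2 Lplus Lminus →
        ∀ [ContinuousSMul ℤ_[2] (A.tateModule 2)] (Y : A.FineSelmerDualData κ γ),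
        ∀ 𝔭' : PrimeSpectrum (IwasawaAlgebra 2), 𝔭'.asIdeal.height = 1 →
          PowerSeries.C (2 : ℤ_[2]) ∉ 𝔭'.asIdeal →
        ∀ (I : Kato2004.IwasawaH1Data A 2 κ γ)
          (pair : ∀ n : ℕ, H1 (tateRep A 2) (κ.layerSubgroup n) →ₗ[ℤ_[2]]
            (localLayerPointsOfEmb κ (closureEmb (K := ℚ) (v.adicCompletion ℚ)) A n →+ ℤ_[2])),
          -- (P1) projection formula
          (∀ (n : ℕ) (x : H1 (tateRep A 2) (κ.layerSubgroup (n + 1))) (Q : localPoints A (v.adicCompletion ℚ))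
            (hQ : Q ∈ localLayerPointsOfEmb κ (closureEmb (K := ℚ) (v.adicCompletion ℚ)) A n),
            pair n (layerCores (tateRep A 2) κ n x) ⟨Q, hQ⟩ =
              pair (n + 1) x ⟨Q, localLayerPointsOfEmb_mono κ (closureEmb (K := ℚ) (v.adicCompletion ℚ)) A (Nat.le_succ n) hQ⟩) →
          -- (P2) Galois invariance, for EVERY `g ∈ Γ_v`
          (∀ (n : ℕ) (g : Field.absoluteGaloisGroup (v.adicCompletion ℚ)) (y : H1 (tateRep A 2) (κ.layerSubgroup n))
            (Q : localPoints A (v.adicCompletion ℚ))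
            (hQ : Q ∈ localLayerPointsOfEmb κ (closureEmb (K := ℚ) (v.adicCompletion ℚ)) A n),
            pair n (conjMap (tateRep A 2).toTopRep (κ.layerSubgroup n) (resGalOfEmb (closureEmb (K := ℚ) (v.adicCompletion ℚ)) g) 1 y)
              ⟨g • Q, smul_mem_localLayerPointsOfEmb κ (closureEmb (K := ℚ) (v.adicCompletion ℚ)) A n g hQ⟩ = pair n y ⟨Q, hQ⟩) →
          -- (P3) residue clause: `pair` IS the `T₂A`-adic local Tate pairing (THE Weil pairings of the tree)
          (∀ (n k : ℕ) (x : H1 (tateRep A 2) (κ.layerSubgroup n))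
            (Q : localLayerPointsOfEmb κ (closureEmb (K := ℚ) (v.adicCompletion ℚ)) A n),
            PadicInt.toZModPow k (pair n x Q) =
              LayerPairing.layerPairingPk A κ v (LayerPairing.weilTowerPk A) (LayerPairing.weilTowerPk_pow A)
                (LayerPairing.weilTowerPk_add_left A) (LayerPairing.weilTowerPk_add_right A) (LayerPairing.weilTowerPk_smul A)
                n k x Q) →
        ∃ (g : Field.absoluteGaloisGroup (v.adicCompletion ℚ))
          (_ : κ.IsTopGenerator (resGalOfEmb (closureEmb (K := ℚ) (v.adicCompletion ℚ)) g))
          (d : ℕ → localPoints A (v.adicCompletion ℚ)) (s : I.H) (m : ℕ),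
          (∀ n, d n ∈ localLayerPointsOfEmb κ (closureEmb (K := ℚ) (v.adicCompletion ℚ)) A n) ∧
          (∀ n, localTraceOfEmb κ (closureEmb (K := ℚ) (v.adicCompletion ℚ)) A (n + 1) (n + 2) (d (n + 2)) = -d n) ∧
          (∀ n : ℕ, 1 ≤ n → ∀ P ∈ localLayerPointsOfEmb κ (closureEmb (K := ℚ) (v.adicCompletion ℚ)) A n,
            ∃ B ∈ AddSubgroup.closure (Set.range fun σ : Field.absoluteGaloisGroup (v.adicCompletion ℚ) ↦ σ • d n),
              ∃ P' ∈ localLayerPointsOfEmb κ (closureEmb (K := ℚ) (v.adicCompletion ℚ)) A (n - 1),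
              ∃ R ∈ localLayerPointsOfEmb κ (closureEmb (K := ℚ) (v.adicCompletion ℚ)) A n, P = B + P' + 2 • R) ∧
          (∀ P ∈ localLayerPointsOfEmb κ (closureEmb (K := ℚ) (v.adicCompletion ℚ)) A 0,
            ∃ a : ℤ, ∃ R ∈ localLayerPointsOfEmb κ (closureEmb (K := ℚ) (v.adicCompletion ℚ)) A 0, P = a • d 0 + 2 • R) ∧
          -- (PT♭)_layer: the deep Poitou–Tate half, read on THE pairing
          (∀ z : localTowerPointsOfEmb κ (closureEmb (K := ℚ) (v.adicCompletion ℚ)) A →+ ℤ_[2],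
            (∀ (t : A.subgroupH1 2 κ.kerSubgroup), t ∈ signedSelmerInfty A κ 1 →
              ∀ (φ : contOneCocycles (discreteTopRep κ.kerSubgroup (A.geomPrimaryTorsion 2)))
                (Q : localPoints A (v.adicCompletion ℚ)) (k : ℕ), oneCocycleClass _ φ = t →
              ∀ hQ : 2 ^ k • Q ∈ (⨆ n, signedLocalPoints κ (v.adicCompletion ℚ) A 1 n),
              (∀ τ : localSubgroupOfEmb κ.kerSubgroup (closureEmb (K := ℚ) (v.adicCompletion ℚ)),
                pointsMapOfEmb A (closureEmb (K := ℚ) (v.adicCompletion ℚ))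
                    ((φ.1 (resGalSubgroupOfEmb κ.kerSubgroup _ τ) : A.geomPrimaryTorsion 2) : A.geomPoints) =
                  (τ : Field.absoluteGaloisGroup (v.adicCompletion ℚ)) • Q - Q) →
              (PadicInt.toZModPow k
                  (z ⟨2 ^ k • Q, SignedKatoOffTwo.KummerPoint.iSup_signedLocalPoints_le_localTowerPointsOfEmb A 2 κ 1 v hQ⟩)).val •
                ((((2 : ℚ) ^ k)⁻¹ : ℚ) : AddCircle (1 : ℚ)) = 0) →
            ∃ x : I.H, ∀ (n : ℕ) (Q : localPoints A (v.adicCompletion ℚ))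
              (hQ : Q ∈ signedLocalPointsOfEmb κ (closureEmb (K := ℚ) (v.adicCompletion ℚ)) A 1 n),
              (2 : ℤ_[2]) ^ m *
                  z ⟨Q, localLayerPointsOfEmb_le_localTowerPointsOfEmb κ _ A n (signedLocalPointsOfEmb_le κ _ A 1 n hQ)⟩ =
                pair n (I.proj n x) ⟨Q, signedLocalPointsOfEmb_le κ _ A 1 n hQ⟩) ∧
          -- (ERL_pair) ON THE layer pairings: `ν·P_{n,d_n}(pair n (I.proj n s)) ≡ μ·θ_n (mod ω_n)` in `Λ ⊗ ℚ₂`, `μ, ν ∉ 𝔭'`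
          (∃ μ ν : IwasawaAlgebra 2, μ ∉ 𝔭'.asIdeal ∧ ν ∉ 𝔭'.asIdeal ∧
            ∀ n : ℕ, ∃ (m : ℕ) (q : IwasawaAlgebra 2),
              PowerSeries.C ((2 : ℚ_[2]) ^ m) *
                  (iwasawaToPowerSeries 2 μ * ((mazurTateElement f 2 n).map (algebraMap ℚ ℚ_[2]) : PowerSeries ℚ_[2]) -
                    iwasawaToPowerSeries 2 (ν * pairingSum A (localLayerPointsOfEmb κ (closureEmb (K := ℚ) (v.adicCompletion ℚ)) A n)
                      g n (d n) (pair n (I.proj n s)))) =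
                iwasawaToPowerSeries 2 (((cyclotomicOmega 2 n).map (Int.castRingHom ℤ_[2]) : PowerSeries ℤ_[2]) * q)) ∧
          -- (g)^ι the CM `𝐇¹`-side comparison, print-exact mixed-prime form
          lengthAt (IwasawaAlgebra 2) (I.H ⧸ Submodule.span (IwasawaAlgebra 2) {s}) 𝔭' ≤
            lengthAt (IwasawaAlgebra 2) Y.X (PrimeSpectrum.comap (IwasawaAlgebra.invol 2).toRingHom 𝔭')) :
    Summit.BirchSwinnertonDyer.BirchSwinnertonDyer.Theses.ThetaPartnerAtTwo.SignedMainConjectureCMTwoRankZeroOfPubOfFlat :=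
  fun hBF hmod hLrat hGZK h2 hC h412 hcork hP108 hWL hμ A _ _ hcm hr hss ha ↦
    signedMainConjectureCMTwoRankZero_body_of_pub_of_offTwoLower_of_flat hBF hmod hLrat hGZK h2 hC h412 hcork hP108 hWL
      (offTwoLower_of_coreLowerPair hpair) hμ A hcm hr hss ha

/-- **K2R0P♭ BY NAME from the two-stub split (S_PT) ∧ (S_ZETA)** (`offTwoLower_of_poitouTateDeepTwo_of_zetaErlLower`): PUB¹⁰ → FLAT → the K2r0
body. CONDITIONAL on `hPT`, `hzeta`; closes nothing. [cite: Kobayashi2003, (7.17)–(7.21), Thm. 7.3 (pp. 12–13)] [cite: MilneADT2006, Ch. I, Thm. 4.10(b)]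
[cite: Kato2004Asterisque, Thm. 12.5 (p. 222), Conj. 12.10 (p. 224), §17.13 (p. 280)] [cite: PollackRubin2004, Thm. 7.3] -/
theorem signedMainConjectureCMTwoRankZeroOfPubOfFlat_of_poitouTateDeepTwo_of_zetaErlLower
    (hPT : ∀ (v : HeightOneSpectrum (𝓞 ℚ)), ((2 : ℕ) : 𝓞 ℚ) ∈ v.asIdeal →
      ∀ (A : WeierstrassCurve ℚ) [A.IsElliptic] [A.IsGloballyMinimal],
        A.HasCM → A.analyticRank = 0 → GoodSS A 2 → A.frobeniusTrace 2 = 0 →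
        ∀ (κ : ZpExtension ℚ 2) (γ : Field.absoluteGaloisGroup ℚ),
          κ.IsCyclotomic → κ.IsTopGenerator γ →
        ∀ [ContinuousSMul ℤ_[2] (A.tateModule 2)] (I : Kato2004.IwasawaH1Data A 2 κ γ)
          (pair : ∀ n : ℕ, H1 (tateRep A 2) (κ.layerSubgroup n) →ₗ[ℤ_[2]]
            (localLayerPointsOfEmb κ (closureEmb (K := ℚ) (v.adicCompletion ℚ)) A n →+ ℤ_[2])),
          -- (P3) in Literature names: `pair` IS the `T₂A`-adic local Tate pairing
          (∀ (n k : ℕ) (x : H1 (tateRep A 2) (κ.layerSubgroup n))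
            (Q : localLayerPointsOfEmb κ (closureEmb (K := ℚ) (v.adicCompletion ℚ)) A n),
            PadicInt.toZModPow k (pair n x Q) = CyclotomicLayer.tatePairingPk A κ v n k x Q) →
        ∃ m : ℕ,
          (∀ z : localTowerPointsOfEmb κ (closureEmb (K := ℚ) (v.adicCompletion ℚ)) A →+ ℤ_[2],
            (∀ (t : A.subgroupH1 2 κ.kerSubgroup), t ∈ signedSelmerInfty A κ 1 →
              ∀ (φ : contOneCocycles (discreteTopRep κ.kerSubgroup (A.geomPrimaryTorsion 2)))
                (Q : localPoints A (v.adicCompletion ℚ)) (k : ℕ), oneCocycleClass _ φ = t →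
              ∀ hQ : 2 ^ k • Q ∈ (⨆ n, signedLocalPoints κ (v.adicCompletion ℚ) A 1 n),
              (∀ τ : localSubgroupOfEmb κ.kerSubgroup (closureEmb (K := ℚ) (v.adicCompletion ℚ)),
                pointsMapOfEmb A (closureEmb (K := ℚ) (v.adicCompletion ℚ))
                    ((φ.1 (resGalSubgroupOfEmb κ.kerSubgroup _ τ) : A.geomPrimaryTorsion 2) : A.geomPoints) =
                  (τ : Field.absoluteGaloisGroup (v.adicCompletion ℚ)) • Q - Q) →
              (PadicInt.toZModPow k
                  (z ⟨2 ^ k • Q, SignedKatoOffTwo.KummerPoint.iSup_signedLocalPoints_le_localTowerPointsOfEmb A 2 κ 1 v hQ⟩)).val •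
                ((((2 : ℚ) ^ k)⁻¹ : ℚ) : AddCircle (1 : ℚ)) = 0) →
            ∃ x : I.H, ∀ (n : ℕ) (Q : localPoints A (v.adicCompletion ℚ))
              (hQ : Q ∈ signedLocalPointsOfEmb κ (closureEmb (K := ℚ) (v.adicCompletion ℚ)) A 1 n),
              (2 : ℤ_[2]) ^ m *
                  z ⟨Q, localLayerPointsOfEmb_le_localTowerPointsOfEmb κ _ A n (signedLocalPointsOfEmb_le κ _ A 1 n hQ)⟩ =
                pair n (I.proj n x) ⟨Q, signedLocalPointsOfEmb_le κ _ A 1 n hQ⟩))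
    (hzeta : ∀ (v : HeightOneSpectrum (𝓞 ℚ)), ((2 : ℕ) : 𝓞 ℚ) ∈ v.asIdeal →
      ∀ (A : WeierstrassCurve ℚ) [A.IsElliptic] [A.IsGloballyMinimal],
        A.HasCM → A.analyticRank = 0 → GoodSS A 2 → A.frobeniusTrace 2 = 0 →
        2 ∣ A.shaOrder * A.tamagawaProduct →
        ∀ (κ : ZpExtension ℚ 2) (γ : Field.absoluteGaloisGroup ℚ),
          κ.IsCyclotomic → κ.IsTopGenerator γ → IsCyclotomicVariable 2 γ →
        ∀ [NeZero (A.conductorNorm ℤ)] (f : CuspForm (Gamma0 (A.conductorNorm ℤ)) 2),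
          IsNewformOf A f → ∀ (ϖ : ℚ), (ϖ : ℝ) * A.realPeriodRat = plusPeriod f →
        ∀ (Lplus Lminus : IwasawaAlgebra 2), IsPollackPair f 2 Lplus Lminus →
        ∀ [ContinuousSMul ℤ_[2] (A.tateModule 2)] (Y : A.FineSelmerDualData κ γ),
        ∀ 𝔭' : PrimeSpectrum (IwasawaAlgebra 2), 𝔭'.asIdeal.height = 1 →
          PowerSeries.C (2 : ℤ_[2]) ∉ 𝔭'.asIdeal →
        ∀ (I : Kato2004.IwasawaH1Data A 2 κ γ)
          (pair : ∀ n : ℕ, H1 (tateRep A 2) (κ.layerSubgroup n) →ₗ[ℤ_[2]]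
            (localLayerPointsOfEmb κ (closureEmb (K := ℚ) (v.adicCompletion ℚ)) A n →+ ℤ_[2])),
          -- (P1) projection formula
          (∀ (n : ℕ) (x : H1 (tateRep A 2) (κ.layerSubgroup (n + 1))) (Q : localPoints A (v.adicCompletion ℚ))
            (hQ : Q ∈ localLayerPointsOfEmb κ (closureEmb (K := ℚ) (v.adicCompletion ℚ)) A n),
            pair n (layerCores (tateRep A 2) κ n x) ⟨Q, hQ⟩ =
              pair (n + 1) x ⟨Q, localLayerPointsOfEmb_mono κ (closureEmb (K := ℚ) (v.adicCompletion ℚ)) A (Nat.le_succ n) hQ⟩) →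
          -- (P2) Galois invariance, for EVERY `g ∈ Γ_v`
          (∀ (n : ℕ) (g : Field.absoluteGaloisGroup (v.adicCompletion ℚ)) (y : H1 (tateRep A 2) (κ.layerSubgroup n))
            (Q : localPoints A (v.adicCompletion ℚ))
            (hQ : Q ∈ localLayerPointsOfEmb κ (closureEmb (K := ℚ) (v.adicCompletion ℚ)) A n),
            pair n (conjMap (tateRep A 2).toTopRep (κ.layerSubgroup n) (resGalOfEmb (closureEmb (K := ℚ) (v.adicCompletion ℚ)) g) 1 y)
              ⟨g • Q, smul_mem_localLayerPointsOfEmb κ (closureEmb (K := ℚ) (v.adicCompletion ℚ)) A n g hQ⟩ = pair n y ⟨Q, hQ⟩) →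
          -- (P3) residue clause: `pair` IS the `T₂A`-adic local Tate pairing (THE Weil pairings of the tree)
          (∀ (n k : ℕ) (x : H1 (tateRep A 2) (κ.layerSubgroup n))
            (Q : localLayerPointsOfEmb κ (closureEmb (K := ℚ) (v.adicCompletion ℚ)) A n),
            PadicInt.toZModPow k (pair n x Q) =
              LayerPairing.layerPairingPk A κ v (LayerPairing.weilTowerPk A) (LayerPairing.weilTowerPk_pow A)
                (LayerPairing.weilTowerPk_add_left A) (LayerPairing.weilTowerPk_add_right A) (LayerPairing.weilTowerPk_smul A)
                n k x Q) →
        ∃ (g : Field.absoluteGaloisGroup (v.adicCompletion ℚ))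
          (_ : κ.IsTopGenerator (resGalOfEmb (closureEmb (K := ℚ) (v.adicCompletion ℚ)) g))
          (d : ℕ → localPoints A (v.adicCompletion ℚ)) (s : I.H),
          (∀ n, d n ∈ localLayerPointsOfEmb κ (closureEmb (K := ℚ) (v.adicCompletion ℚ)) A n) ∧
          (∀ n, localTraceOfEmb κ (closureEmb (K := ℚ) (v.adicCompletion ℚ)) A (n + 1) (n + 2) (d (n + 2)) = -d n) ∧
          (∀ n : ℕ, 1 ≤ n → ∀ P ∈ localLayerPointsOfEmb κ (closureEmb (K := ℚ) (v.adicCompletion ℚ)) A n,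
            ∃ B ∈ AddSubgroup.closure (Set.range fun σ : Field.absoluteGaloisGroup (v.adicCompletion ℚ) ↦ σ • d n),
              ∃ P' ∈ localLayerPointsOfEmb κ (closureEmb (K := ℚ) (v.adicCompletion ℚ)) A (n - 1),
              ∃ R ∈ localLayerPointsOfEmb κ (closureEmb (K := ℚ) (v.adicCompletion ℚ)) A n, P = B + P' + 2 • R) ∧
          (∀ P ∈ localLayerPointsOfEmb κ (closureEmb (K := ℚ) (v.adicCompletion ℚ)) A 0,
            ∃ a : ℤ, ∃ R ∈ localLayerPointsOfEmb κ (closureEmb (K := ℚ) (v.adicCompletion ℚ)) A 0, P = a • d 0 + 2 • R) ∧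
          -- (ERL_pair) ON THE layer pairings: `ν·P_{n,d_n}(pair n (I.proj n s)) ≡ μ·θ_n (mod ω_n)` in `Λ ⊗ ℚ₂`, `μ, ν ∉ 𝔭'`
          (∃ μ ν : IwasawaAlgebra 2, μ ∉ 𝔭'.asIdeal ∧ ν ∉ 𝔭'.asIdeal ∧
            ∀ n : ℕ, ∃ (m : ℕ) (q : IwasawaAlgebra 2),
              PowerSeries.C ((2 : ℚ_[2]) ^ m) *
                  (iwasawaToPowerSeries 2 μ * ((mazurTateElement f 2 n).map (algebraMap ℚ ℚ_[2]) : PowerSeries ℚ_[2]) -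
                    iwasawaToPowerSeries 2 (ν * pairingSum A (localLayerPointsOfEmb κ (closureEmb (K := ℚ) (v.adicCompletion ℚ)) A n)
                      g n (d n) (pair n (I.proj n s)))) =
                iwasawaToPowerSeries 2 (((cyclotomicOmega 2 n).map (Int.castRingHom ℤ_[2]) : PowerSeries ℤ_[2]) * q)) ∧
          -- (g)^ι the CM `𝐇¹`-side comparison, print-exact mixed-prime form
          lengthAt (IwasawaAlgebra 2) (I.H ⧸ Submodule.span (IwasawaAlgebra 2) {s}) 𝔭' ≤
            lengthAt (IwasawaAlgebra 2) Y.X (PrimeSpectrum.comap (IwasawaAlgebra.invol 2).toRingHom 𝔭')) :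
    Summit.BirchSwinnertonDyer.BirchSwinnertonDyer.Theses.ThetaPartnerAtTwo.SignedMainConjectureCMTwoRankZeroOfPubOfFlat :=
  fun hBF hmod hLrat hGZK h2 hC h412 hcork hP108 hWL hμ A _ _ hcm hr hss ha ↦
    signedMainConjectureCMTwoRankZero_body_of_pub_of_offTwoLower_of_flat hBF hmod hLrat hGZK h2 hC h412 hcork hP108 hWL
      (offTwoLower_of_poitouTateDeepTwo_of_zetaErlLower hPT hzeta) hμ A hcm hr hss ha

/-- **K2R0P♭ BY NAME from (S_PT)_gen ∧ (S_ZETA)** (`offTwoLower_of_poitouTateDeepTwoGen_of_zetaErlLower`). CONDITIONAL on `hPT`, `hzeta`; closes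
nothing. [cite: Kobayashi2003, (7.17)–(7.21), Thm. 7.3 (pp. 12–13)] [cite: MilneADT2006, Ch. I, Thm. 4.10(b)] [cite: PollackRubin2004, Thm. 7.3] -/
theorem signedMainConjectureCMTwoRankZeroOfPubOfFlat_of_poitouTateDeepTwoGen_of_zetaErlLower
    (hPT : ∀ (v : HeightOneSpectrum (𝓞 ℚ)), ((2 : ℕ) : 𝓞 ℚ) ∈ v.asIdeal →
      ∀ (A : WeierstrassCurve ℚ) [A.IsElliptic],
        ∀ (κ : ZpExtension ℚ 2) (γ : Field.absoluteGaloisGroup ℚ),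
          κ.IsCyclotomic → κ.IsTopGenerator γ →
        ∀ [ContinuousSMul ℤ_[2] (A.tateModule 2)] (I : Kato2004.IwasawaH1Data A 2 κ γ)
          (pair : ∀ n : ℕ, H1 (tateRep A 2) (κ.layerSubgroup n) →ₗ[ℤ_[2]]
            (localLayerPointsOfEmb κ (closureEmb (K := ℚ) (v.adicCompletion ℚ)) A n →+ ℤ_[2])),
          -- (P3) in Literature names: `pair` IS the `T₂A`-adic local Tate pairing
          (∀ (n k : ℕ) (x : H1 (tateRep A 2) (κ.layerSubgroup n))
            (Q : localLayerPointsOfEmb κ (closureEmb (K := ℚ) (v.adicCompletion ℚ)) A n),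
            PadicInt.toZModPow k (pair n x Q) = CyclotomicLayer.tatePairingPk A κ v n k x Q) →
        ∃ m : ℕ,
          (∀ z : localTowerPointsOfEmb κ (closureEmb (K := ℚ) (v.adicCompletion ℚ)) A →+ ℤ_[2],
            (∀ (t : A.subgroupH1 2 κ.kerSubgroup), t ∈ signedSelmerInfty A κ 1 →
              ∀ (φ : contOneCocycles (discreteTopRep κ.kerSubgroup (A.geomPrimaryTorsion 2)))
                (Q : localPoints A (v.adicCompletion ℚ)) (k : ℕ), oneCocycleClass _ φ = t →
              ∀ hQ : 2 ^ k • Q ∈ (⨆ n, signedLocalPoints κ (v.adicCompletion ℚ) A 1 n),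
              (∀ τ : localSubgroupOfEmb κ.kerSubgroup (closureEmb (K := ℚ) (v.adicCompletion ℚ)),
                pointsMapOfEmb A (closureEmb (K := ℚ) (v.adicCompletion ℚ))
                    ((φ.1 (resGalSubgroupOfEmb κ.kerSubgroup _ τ) : A.geomPrimaryTorsion 2) : A.geomPoints) =
                  (τ : Field.absoluteGaloisGroup (v.adicCompletion ℚ)) • Q - Q) →
              (PadicInt.toZModPow k
                  (z ⟨2 ^ k • Q, SignedKatoOffTwo.KummerPoint.iSup_signedLocalPoints_le_localTowerPointsOfEmb A 2 κ 1 v hQ⟩)).val •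
                ((((2 : ℚ) ^ k)⁻¹ : ℚ) : AddCircle (1 : ℚ)) = 0) →
            ∃ x : I.H, ∀ (n : ℕ) (Q : localPoints A (v.adicCompletion ℚ))
              (hQ : Q ∈ signedLocalPointsOfEmb κ (closureEmb (K := ℚ) (v.adicCompletion ℚ)) A 1 n),
              (2 : ℤ_[2]) ^ m *
                  z ⟨Q, localLayerPointsOfEmb_le_localTowerPointsOfEmb κ _ A n (signedLocalPointsOfEmb_le κ _ A 1 n hQ)⟩ =
                pair n (I.proj n x) ⟨Q, signedLocalPointsOfEmb_le κ _ A 1 n hQ⟩))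
    (hzeta : ∀ (v : HeightOneSpectrum (𝓞 ℚ)), ((2 : ℕ) : 𝓞 ℚ) ∈ v.asIdeal →
      ∀ (A : WeierstrassCurve ℚ) [A.IsElliptic] [A.IsGloballyMinimal],
        A.HasCM → A.analyticRank = 0 → GoodSS A 2 → A.frobeniusTrace 2 = 0 →
        2 ∣ A.shaOrder * A.tamagawaProduct →
        ∀ (κ : ZpExtension ℚ 2) (γ : Field.absoluteGaloisGroup ℚ),
          κ.IsCyclotomic → κ.IsTopGenerator γ → IsCyclotomicVariable 2 γ →
        ∀ [NeZero (A.conductorNorm ℤ)] (f : CuspForm (Gamma0 (A.conductorNorm ℤ)) 2),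
          IsNewformOf A f → ∀ (ϖ : ℚ), (ϖ : ℝ) * A.realPeriodRat = plusPeriod f →
        ∀ (Lplus Lminus : IwasawaAlgebra 2), IsPollackPair f 2 Lplus Lminus →
        ∀ [ContinuousSMul ℤ_[2] (A.tateModule 2)] (Y : A.FineSelmerDualData κ γ),
        ∀ 𝔭' : PrimeSpectrum (IwasawaAlgebra 2), 𝔭'.asIdeal.height = 1 →
          PowerSeries.C (2 : ℤ_[2]) ∉ 𝔭'.asIdeal →
        ∀ (I : Kato2004.IwasawaH1Data A 2 κ γ)
          (pair : ∀ n : ℕ, H1 (tateRep A 2) (κ.layerSubgroup n) →ₗ[ℤ_[2]]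
            (localLayerPointsOfEmb κ (closureEmb (K := ℚ) (v.adicCompletion ℚ)) A n →+ ℤ_[2])),
          -- (P1) projection formula
          (∀ (n : ℕ) (x : H1 (tateRep A 2) (κ.layerSubgroup (n + 1))) (Q : localPoints A (v.adicCompletion ℚ))
            (hQ : Q ∈ localLayerPointsOfEmb κ (closureEmb (K := ℚ) (v.adicCompletion ℚ)) A n),
            pair n (layerCores (tateRep A 2) κ n x) ⟨Q, hQ⟩ =
              pair (n + 1) x ⟨Q, localLayerPointsOfEmb_mono κ (closureEmb (K := ℚ) (v.adicCompletion ℚ)) A (Nat.le_succ n) hQ⟩) →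
          -- (P2) Galois invariance, for EVERY `g ∈ Γ_v`
          (∀ (n : ℕ) (g : Field.absoluteGaloisGroup (v.adicCompletion ℚ)) (y : H1 (tateRep A 2) (κ.layerSubgroup n))
            (Q : localPoints A (v.adicCompletion ℚ))
            (hQ : Q ∈ localLayerPointsOfEmb κ (closureEmb (K := ℚ) (v.adicCompletion ℚ)) A n),
            pair n (conjMap (tateRep A 2).toTopRep (κ.layerSubgroup n) (resGalOfEmb (closureEmb (K := ℚ) (v.adicCompletion ℚ)) g) 1 y)
              ⟨g • Q, smul_mem_localLayerPointsOfEmb κ (closureEmb (K := ℚ) (v.adicCompletion ℚ)) A n g hQ⟩ = pair n y ⟨Q, hQ⟩) →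
          -- (P3) residue clause: `pair` IS the `T₂A`-adic local Tate pairing (THE Weil pairings of the tree)
          (∀ (n k : ℕ) (x : H1 (tateRep A 2) (κ.layerSubgroup n))
            (Q : localLayerPointsOfEmb κ (closureEmb (K := ℚ) (v.adicCompletion ℚ)) A n),
            PadicInt.toZModPow k (pair n x Q) =
              LayerPairing.layerPairingPk A κ v (LayerPairing.weilTowerPk A) (LayerPairing.weilTowerPk_pow A)
                (LayerPairing.weilTowerPk_add_left A) (LayerPairing.weilTowerPk_add_right A) (LayerPairing.weilTowerPk_smul A)
                n k x Q) →
        ∃ (g : Field.absoluteGaloisGroup (v.adicCompletion ℚ))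
          (_ : κ.IsTopGenerator (resGalOfEmb (closureEmb (K := ℚ) (v.adicCompletion ℚ)) g))
          (d : ℕ → localPoints A (v.adicCompletion ℚ)) (s : I.H),
          (∀ n, d n ∈ localLayerPointsOfEmb κ (closureEmb (K := ℚ) (v.adicCompletion ℚ)) A n) ∧
          (∀ n, localTraceOfEmb κ (closureEmb (K := ℚ) (v.adicCompletion ℚ)) A (n + 1) (n + 2) (d (n + 2)) = -d n) ∧
          (∀ n : ℕ, 1 ≤ n → ∀ P ∈ localLayerPointsOfEmb κ (closureEmb (K := ℚ) (v.adicCompletion ℚ)) A n,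
            ∃ B ∈ AddSubgroup.closure (Set.range fun σ : Field.absoluteGaloisGroup (v.adicCompletion ℚ) ↦ σ • d n),
              ∃ P' ∈ localLayerPointsOfEmb κ (closureEmb (K := ℚ) (v.adicCompletion ℚ)) A (n - 1),
              ∃ R ∈ localLayerPointsOfEmb κ (closureEmb (K := ℚ) (v.adicCompletion ℚ)) A n, P = B + P' + 2 • R) ∧
          (∀ P ∈ localLayerPointsOfEmb κ (closureEmb (K := ℚ) (v.adicCompletion ℚ)) A 0,
            ∃ a : ℤ, ∃ R ∈ localLayerPointsOfEmb κ (closureEmb (K := ℚ) (v.adicCompletion ℚ)) A 0, P = a • d 0 + 2 • R) ∧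
          -- (ERL_pair) ON THE layer pairings: `ν·P_{n,d_n}(pair n (I.proj n s)) ≡ μ·θ_n (mod ω_n)` in `Λ ⊗ ℚ₂`, `μ, ν ∉ 𝔭'`
          (∃ μ ν : IwasawaAlgebra 2, μ ∉ 𝔭'.asIdeal ∧ ν ∉ 𝔭'.asIdeal ∧
            ∀ n : ℕ, ∃ (m : ℕ) (q : IwasawaAlgebra 2),
              PowerSeries.C ((2 : ℚ_[2]) ^ m) *
                  (iwasawaToPowerSeries 2 μ * ((mazurTateElement f 2 n).map (algebraMap ℚ ℚ_[2]) : PowerSeries ℚ_[2]) -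
                    iwasawaToPowerSeries 2 (ν * pairingSum A (localLayerPointsOfEmb κ (closureEmb (K := ℚ) (v.adicCompletion ℚ)) A n)
                      g n (d n) (pair n (I.proj n s)))) =
                iwasawaToPowerSeries 2 (((cyclotomicOmega 2 n).map (Int.castRingHom ℤ_[2]) : PowerSeries ℤ_[2]) * q)) ∧
          -- (g)^ι the CM `𝐇¹`-side comparison, print-exact mixed-prime form
          lengthAt (IwasawaAlgebra 2) (I.H ⧸ Submodule.span (IwasawaAlgebra 2) {s}) 𝔭' ≤
            lengthAt (IwasawaAlgebra 2) Y.X (PrimeSpectrum.comap (IwasawaAlgebra.invol 2).toRingHom 𝔭')) :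
    Summit.BirchSwinnertonDyer.BirchSwinnertonDyer.Theses.ThetaPartnerAtTwo.SignedMainConjectureCMTwoRankZeroOfPubOfFlat :=
  fun hBF hmod hLrat hGZK h2 hC h412 hcork hP108 hWL hμ A _ _ hcm hr hss ha ↦
    signedMainConjectureCMTwoRankZero_body_of_pub_of_offTwoLower_of_flat hBF hmod hLrat hGZK h2 hC h412 hcork hP108 hWL
      (offTwoLower_of_poitouTateDeepTwoGen_of_zetaErlLower hPT hzeta) hμ A hcm hr hss ha

end SignedLowerOffTwo

end Summit.BirchSwinnertonDyer.BirchSwinnertonDyer.Theorems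

end
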